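import Summits.Ventures.PercRepro.Night2ThreeTwoGoodTargets

/-!
# PercRepro — the cell `(3, 2)` for `|V| ≥ 11`: the basis pairs' inequality from the quadratic count sum
(night-2, gen 25)

The fair-share inequality (ii) of a lossy basis pair `(B, z)` — `loss B z ≤ rhoL B z · lossIncomeH B z`, i.e.
`lossIncomeH B z ≥ 2^{n−4} − 1` — from its GOOD targets: the targets `T ⊇ B ∪ {z}` with at least three points off the
common line `ℓ`.  There `cap3 ≥ 1/60` (`cap3_ge_of_three_off`), `1 − 3/20` at the two top levels, and the mass
is at most `lineCount i j · E/(2^{n−4} − 1)` (`pi2MassH_le_lineCount`), `(i, j) = (|T′ ∩ ℓ|, |T′ ∖ ℓ|)`.  Grouping the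
good targets by `(i, j)` — at least `C(|ℓ| − i₀, i − i₀)·C(y − j₀, j − j₀)` of them, `(i₀, j₀)` the profile of the
covering set — gives `lossIncomeH ≥ (2^{n−4} − 1)/E · qSum`, so (ii) holds as soon as `E ≤ qSum |ℓ| y i₀ j₀ n`
(proofs/NIGHT-2-g25.md §5‴: `qSum ≥ 1 ≥ E` for every `n ≥ 13`, `y ≤ 6`, numerically).

* `cFloor n s` — the capacity floor of a good target of size `s` (`1 − 3/20` at `n ≤ s + 2`, else `1/60`);
* `qSum L y i₀ j₀ n` — the quadratic count sum;
* `rhoL_le_pi2MassH`, `lossIncomeH_ge_of_subfamily` — the income from a subfamily of targets with bounds;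
* `card_fiber_ge_choose_mul_choose` — the good targets of profile `(i, j)` number at least the binomial product.
The assembly **`basis_pair_fair_of_qSum`** — (ii) at a basis pair from `E ≤ qSum` — is in `Night2ThreeTwoBasisAssemblyB`.
-/

namespace PercRepro.Shadow

open Finset PerFlat ThmH

variable {α : Type*} [DecidableEq α] {M : Matroid α} [M.Finite]

/-- The capacity floor of a good target with `s` points off the coloops in a flat with `n`. -/
def cFloor (n s : ℕ) : ℚ := if n ≤ s + 2 then 1 - 3 / 20 else 1 / 60

/-- The quadratic count sum of a basis pair of profile `(i₀, j₀)`: over the profiles `(i, j)` of its good targets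
(`j ≥ 3`, `i ≥ i₀`, `j ≥ j₀`, `(i, j) ≠ (i₀, j₀)`), the number of targets of that profile times the floor over the line count. -/
def qSum (L y i₀ j₀ n : ℕ) : ℚ :=
  ∑ i ∈ Finset.range (L + 1), ∑ j ∈ Finset.range (y + 1),
    if 3 ≤ j ∧ i₀ ≤ i ∧ j₀ ≤ j ∧ (i, j) ≠ (i₀, j₀) then
      ((L - i₀).choose (i - i₀) * (y - j₀).choose (j - j₀) : ℚ) * cFloor n (i + j) / (lineCount i j : ℚ)
    else 0

omit [DecidableEq α] [M.Finite] in
/-- Floors are nonnegative. -/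
theorem cFloor_nonneg (n s : ℕ) : 0 ≤ cFloor n s := by
  unfold cFloor; split_ifs <;> norm_num

section Income

variable {q : ℕ} {G : Finset α} {P : Finset α → Prop} [DecidablePred P]

open scoped Classical in
/-- A non-`P` pair's weight is part of the non-`P` mass of each of its targets. -/
theorem rhoL_le_pi2MassH (hG : G ∈ flatsQ M (q + 1)) (hd : (gr M \ G).card ≤ q) {B : Finset α}
    (hB : B ∈ thinMembers M q G) (hnP : ¬ P B) {z : α} (hz : z ∈ G \ clF M B) {S : Finset α}
    (hS : S ∈ tgtSets M q G B z) : rhoL M q G B z ≤ pi2MassH M q G P S := by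
  unfold pi2MassH
  have hBm : B ∈ (thinMembers M q G).filter (fun B => ¬ P B) := Finset.mem_filter.2 ⟨hB, hnP⟩
  calc rhoL M q G B z = (if S ∈ tgtSets M q G B z then rhoL M q G B z else 0) := by rw [if_pos hS]
    _ ≤ ∑ z' ∈ G \ clF M B, (if S ∈ tgtSets M q G B z' then rhoL M q G B z' else 0) := by
        apply Finset.single_le_sum (f := fun z' => if S ∈ tgtSets M q G B z' then rhoL M q G B z' else 0)
        · intro z' _
          split_ifs
          · exact rhoL_nonneg hG hd B z'
          · exact le_refl _
        · exact hz
    _ ≤ _ := by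
        apply Finset.single_le_sum (f := fun B' => ∑ z' ∈ G \ clF M B',
          (if S ∈ tgtSets M q G B' z' then rhoL M q G B' z' else 0))
        · intro B' _
          apply Finset.sum_nonneg
          intro z' _
          split_ifs
          · exact rhoL_nonneg hG hd B' z'
          · exact le_refl _
        · exact hBm

/-- A positive loss has a positive weight. -/
theorem rhoL_pos_of_loss_ne (hG : G ∈ flatsQ M (q + 1)) (hd : (gr M \ G).card ≤ q) {B : Finset α}
    (hB : B ∈ thinMembers M q G) {z : α} (hz : z ∈ G \ clF M B) (hl : loss M q G B z ≠ 0) :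
    0 < rhoL M q G B z := by
  have h0 := rhoL_nonneg hG hd B z
  rcases h0.lt_or_eq with h | h
  · exact h
  · exfalso
    unfold rhoL at h
    have hl' : 0 < loss M q G B z := lt_of_le_of_ne (loss_nonneg' hG hd B z) (Ne.symm hl)
    have hB' : B ∈ membersIn M (Uq M (q + 2) q) G := (mem_thinMembers.1 hB).1
    have hT : (0 : ℚ) < ((tgtSets M q G B z).card : ℚ) := by
      rw [card_tgtSets hG hB' hz]
      have hm := two_le_card_sdiff_of_not_lay0 hG hd hB' (mem_thinMembers.1 hB).2
      have hsub : (G \ clF M B).erase z ⊆ G \ insert z B := by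
        intro x hx
        rw [Finset.mem_erase, Finset.mem_sdiff] at hx
        rw [Finset.mem_sdiff, Finset.mem_insert]
        exact ⟨hx.2.1, fun h => h.elim hx.1 (fun h' => hx.2.2 (subset_clF (mem_membersIn.1 hB').1 h'))⟩
      have h2 := Finset.card_le_card hsub
      rw [Finset.card_erase_of_mem hz] at h2
      have : 2 ≤ 2 ^ (G \ insert z B).card := by
        calc 2 = 2 ^ 1 := by norm_num
          _ ≤ 2 ^ (G \ insert z B).card := Nat.pow_le_pow_right (by norm_num) (by omega)
      exact_mod_cast (by omega : 0 < 2 ^ (G \ insert z B).card - 1)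
    rw [eq_comm, div_eq_zero_iff] at h
    rcases h with h | h
    · exact hl h
    · linarith

open scoped Classical in
/-- **The income from a subfamily of targets with bounds**: if on a subfamily `𝒯` of the targets of a non-`P` pair the
mass is at most `u` and the capacity `cap3` at least `v ≥ 0`, then `lossIncomeH ≥ Σ_{T ∈ 𝒯} v T / u T`. -/
theorem lossIncomeH_ge_of_subfamily (hG : G ∈ flatsQ M (q + 1)) (hd : (gr M \ G).card ≤ q)
    {dsh : Finset α → α → Finset α → ℚ}
    (hdl : ∀ S ∈ shadowAt M (q + 2) q (Uq M (q + 2) q) G, dload M q G P dsh S ≤ cap2 M q G S)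
    {B : Finset α} (hB : B ∈ thinMembers M q G) (hnP : ¬ P B) {z : α} (hz : z ∈ G \ clF M B)
    (hl : loss M q G B z ≠ 0) {𝒯 : Finset (Finset α)} (h𝒯 : 𝒯 ⊆ tgtSets M q G B z) (u v : Finset α → ℚ)
    (hu : ∀ T ∈ 𝒯, pi2MassH M q G P T ≤ u T) (hv : ∀ T ∈ 𝒯, v T ≤ cap3 M q G P dsh T)
    (hv0 : ∀ T ∈ 𝒯, 0 ≤ v T) : ∑ T ∈ 𝒯, v T / u T ≤ lossIncomeH M q G P dsh B z := by
  have hρ := rhoL_pos_of_loss_ne hG hd hB hz hl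
  unfold lossIncomeH
  calc ∑ T ∈ 𝒯, v T / u T ≤ ∑ T ∈ 𝒯, cap3 M q G P dsh T / pi2MassH M q G P T := by
        apply Finset.sum_le_sum
        intro T hT
        have hPi : 0 < pi2MassH M q G P T := lt_of_lt_of_le hρ (rhoL_le_pi2MassH hG hd hB hnP hz (h𝒯 hT))
        calc v T / u T ≤ v T / pi2MassH M q G P T :=
              div_le_div_of_nonneg_left (hv0 T hT) hPi (hu T hT)
          _ ≤ cap3 M q G P dsh T / pi2MassH M q G P T :=
              div_le_div_of_nonneg_right (hv T hT) hPi.le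
    _ ≤ ∑ T ∈ tgtSets M q G B z, cap3 M q G P dsh T / pi2MassH M q G P T := by
        apply Finset.sum_le_sum_of_subset_of_nonneg h𝒯
        intro T hT _
        exact div_nonneg (cap3_nonneg (hdl T (mem_tgtSets.1 hT).1)) (pi2MassH_nonneg hG hd T)

end Income

section Fibers

variable {G : Finset α}

/-- The profile of a target: `(|T′ ∩ ℓ|, |T′ ∖ ℓ|)`, `T′ = T ∖ K`. -/
def profileAt (K ℓ T : Finset α) : ℕ × ℕ := (((T \ K) ∩ ℓ).card, ((T \ K) \ ℓ).card)

open scoped Classical in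
/-- The good targets of a pair: the targets with at least three points off the line. -/
noncomputable def goodTargets (M : Matroid α) [M.Finite] (G ℓ B : Finset α) (z : α) : Finset (Finset α) :=
  (tgtSets M 5 G B z).filter (fun T => 3 ≤ ((T \ coloops M G) \ ℓ).card)

open scoped Classical in
/-- **The good targets of profile `(i, j)` number at least `C(|ℓ| − i₀, i − i₀) · C(y − j₀, j − j₀)`**, `(i₀, j₀)` the
profile of the covering set `B ∪ {z}` and `y = |V ∖ ℓ|`: the sets `B ∪ {z} ∪ A ∪ W` with `A ⊆ ℓ`, `W ⊆ V ∖ ℓ`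
outside `B ∪ {z}`. -/
theorem card_fiber_ge_choose_mul_choose (hG : G ∈ flatsQ M (5 + 1)) (hd : (gr M \ G).card ≤ 5) {B : Finset α}
    (hB : B ∈ thinMembers M 5 G) {z : α} (hz : z ∈ G \ clF M B) {ℓ : Finset α} (hℓV : ℓ ⊆ G \ coloops M G)
    {i j : ℕ} (h3 : 3 ≤ j) (hne : (i, j) ≠ profileAt (coloops M G) ℓ (insert z B))
    (hi : (profileAt (coloops M G) ℓ (insert z B)).1 ≤ i) (hj : (profileAt (coloops M G) ℓ (insert z B)).2 ≤ j) :
    (ℓ.card - (profileAt (coloops M G) ℓ (insert z B)).1).choose (i - (profileAt (coloops M G) ℓ (insert z B)).1) *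
      (((G \ coloops M G) \ ℓ).card - (profileAt (coloops M G) ℓ (insert z B)).2).choose
        (j - (profileAt (coloops M G) ℓ (insert z B)).2) ≤
      ((goodTargets M G ℓ B z).filter (fun T => profileAt (coloops M G) ℓ T = (i, j))).card := by
  set K := coloops M G with hK
  set Q := insert z B with hQ
  have hB' : B ∈ membersIn M (Uq M (5 + 2) 5) G := (mem_thinMembers.1 hB).1
  have hBU : B ∈ Uq M (5 + 2) 5 := (mem_membersIn.1 hB').1
  have hBG : B ⊆ G := (subset_clF hBU).trans (mem_membersIn.1 hB').2
  have hQG : Q ⊆ G := Finset.insert_subset (Finset.mem_sdiff.1 hz).1 hBG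
  have hKB : K ⊆ B := coloops_subset_of_mem_thinMembers hG hd hB
  have hKQ : K ⊆ Q := hKB.trans (Finset.subset_insert z B)
  simp only [profileAt] at hne hi hj ⊢
  set i₀ := ((Q \ K) ∩ ℓ).card with hi₀
  set j₀ := ((Q \ K) \ ℓ).card with hj₀
  -- the two pools of new points
  set Aℓ := (G \ Q) ∩ ℓ with hAℓ
  set Wℓ := (G \ Q) \ ℓ with hWℓ
  have hAcard : Aℓ.card = ℓ.card - i₀ := by
    have heq : Aℓ = ℓ \ ((Q \ K) ∩ ℓ) := by
      ext a
      simp only [hAℓ, Finset.mem_inter, Finset.mem_sdiff, not_and]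
      constructor
      · rintro ⟨⟨haG, haQ⟩, haℓ⟩
        exact ⟨haℓ, fun h => absurd h.1 haQ⟩
      · rintro ⟨haℓ, h⟩
        have haV := hℓV haℓ
        rw [Finset.mem_sdiff] at haV
        refine ⟨⟨haV.1, fun haQ => ?_⟩, haℓ⟩
        exact h ⟨haQ, haV.2⟩ haℓ
    rw [heq, Finset.card_sdiff_of_subset Finset.inter_subset_right]
  have hWcard : Wℓ.card = ((G \ K) \ ℓ).card - j₀ := by
    have heq : Wℓ = ((G \ K) \ ℓ) \ ((Q \ K) \ ℓ) := by
      ext a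
      simp only [hWℓ, Finset.mem_sdiff, not_and, not_not]
      constructor
      · rintro ⟨⟨haG, haQ⟩, haℓ⟩
        exact ⟨⟨⟨haG, fun haK => haQ (hKQ haK)⟩, haℓ⟩, fun h => absurd h.1 haQ⟩
      · rintro ⟨⟨⟨haG, haK⟩, haℓ⟩, h⟩
        refine ⟨⟨haG, fun haQ => ?_⟩, haℓ⟩
        exact haℓ (h ⟨haQ, haK⟩)
    rw [heq, Finset.card_sdiff_of_subset]
    intro a ha
    rw [Finset.mem_sdiff, Finset.mem_sdiff] at ha ⊢
    exact ⟨⟨hQG ha.1.1, ha.1.2⟩, ha.2⟩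
  rw [← hAcard, ← hWcard, ← Finset.card_powersetCard, ← Finset.card_powersetCard, ← Finset.card_product]
  apply Finset.card_le_card_of_injOn (fun p => Q ∪ p.1 ∪ p.2)
  · intro p hp
    rw [Finset.mem_coe, Finset.mem_product, Finset.mem_powersetCard, Finset.mem_powersetCard] at hp
    obtain ⟨⟨hA, hAc⟩, hW, hWc⟩ := hp
    rw [Finset.mem_coe, Finset.mem_filter]
    -- the profile of `T = Q ∪ A ∪ W`
    have hTK : (Q ∪ p.1 ∪ p.2) \ K = (Q \ K) ∪ p.1 ∪ p.2 := by
      ext a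
      simp only [Finset.mem_sdiff, Finset.mem_union]
      constructor
      · rintro ⟨(h | h) | h, haK⟩
        · exact Or.inl (Or.inl ⟨h, haK⟩)
        · exact Or.inl (Or.inr h)
        · exact Or.inr h
      · rintro ((⟨h, haK⟩ | h) | h)
        · exact ⟨Or.inl (Or.inl h), haK⟩
        · have := hA h
          rw [hAℓ, Finset.mem_inter, Finset.mem_sdiff] at this
          exact ⟨Or.inl (Or.inr h), fun haK => this.1.2 (hKQ haK)⟩
        · have := hW h
          rw [hWℓ, Finset.mem_sdiff, Finset.mem_sdiff] at this
          exact ⟨Or.inr h, fun haK => this.1.2 (hKQ haK)⟩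
    have hAsub : p.1 ⊆ ℓ := hA.trans Finset.inter_subset_right
    have hAQ : Disjoint p.1 (Q \ K) := by
      rw [Finset.disjoint_left]
      intro a ha haQ
      have := hA ha
      rw [hAℓ, Finset.mem_inter, Finset.mem_sdiff] at this
      exact this.1.2 (Finset.mem_sdiff.1 haQ).1
    have hWℓ' : Disjoint p.2 ℓ := by
      rw [Finset.disjoint_left]
      intro a ha haℓ
      have := hW ha
      rw [hWℓ, Finset.mem_sdiff] at this
      exact this.2 haℓ
    have hWQ : Disjoint p.2 (Q \ K) := by
      rw [Finset.disjoint_left]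
      intro a ha haQ
      have := hW ha
      rw [hWℓ, Finset.mem_sdiff, Finset.mem_sdiff] at this
      exact this.1.2 (Finset.mem_sdiff.1 haQ).1
    have hprof1 : (((Q ∪ p.1 ∪ p.2) \ K) ∩ ℓ).card = i := by
      have heq : ((Q ∪ p.1 ∪ p.2) \ K) ∩ ℓ = ((Q \ K) ∩ ℓ) ∪ p.1 := by
        rw [hTK]
        ext a
        simp only [Finset.mem_inter, Finset.mem_union]
        constructor
        · rintro ⟨(h | h) | h, haℓ⟩
          · exact Or.inl ⟨h, haℓ⟩
          · exact Or.inr h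
          · exact absurd haℓ (Finset.disjoint_left.1 hWℓ' h)
        · rintro (⟨h, haℓ⟩ | h)
          · exact ⟨Or.inl (Or.inl h), haℓ⟩
          · exact ⟨Or.inl (Or.inr h), hAsub h⟩
      rw [heq, Finset.card_union_of_disjoint, hAc]
      · omega
      · rw [Finset.disjoint_left]
        intro a ha haA
        exact Finset.disjoint_left.1 hAQ haA (Finset.mem_inter.1 ha).1
    have hprof2 : (((Q ∪ p.1 ∪ p.2) \ K) \ ℓ).card = j := by
      have heq : ((Q ∪ p.1 ∪ p.2) \ K) \ ℓ = ((Q \ K) \ ℓ) ∪ p.2 := by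
        rw [hTK]
        ext a
        simp only [Finset.mem_sdiff, Finset.mem_union]
        constructor
        · rintro ⟨(h | h) | h, haℓ⟩
          · exact Or.inl ⟨h, haℓ⟩
          · exact absurd (hAsub h) haℓ
          · exact Or.inr h
        · rintro (⟨h, haℓ⟩ | h)
          · exact ⟨Or.inl (Or.inl h), haℓ⟩
          · exact ⟨Or.inr h, Finset.disjoint_left.1 hWℓ' h⟩
      rw [heq, Finset.card_union_of_disjoint, hWc]
      · omega
      · rw [Finset.disjoint_left]
        intro a ha haW
        exact Finset.disjoint_left.1 hWQ haW (Finset.mem_sdiff.1 ha).1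
    refine ⟨?_, ?_⟩
    · -- a good target
      unfold goodTargets
      rw [Finset.mem_filter, mem_tgtSets]
      have hTG : Q ∪ p.1 ∪ p.2 ⊆ G :=
        Finset.union_subset (Finset.union_subset hQG (hA.trans (Finset.inter_subset_left.trans Finset.sdiff_subset)))
          (hW.trans (Finset.sdiff_subset.trans Finset.sdiff_subset))
      have hQT : Q ⊆ Q ∪ p.1 ∪ p.2 := Finset.subset_union_left.trans Finset.subset_union_left
      refine ⟨⟨superset_mem_shadowAt hG hB' hz hQT hTG, hQT, ?_⟩, by rw [hprof2]; exact h3⟩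
      -- `|T ∖ B| ≥ 2`: `z` and a point of `A ∪ W`
      have hnonempty : (p.1 ∪ p.2).Nonempty := by
        by_contra hemp
        rw [Finset.not_nonempty_iff_eq_empty, Finset.union_eq_empty] at hemp
        apply hne
        rw [hemp.1, Finset.card_empty] at hAc
        rw [hemp.2, Finset.card_empty] at hWc
        ext <;> simp only <;> omega
      obtain ⟨w, hw⟩ := hnonempty
      have hwQ : w ∉ Q := by
        rcases Finset.mem_union.1 hw with h | h
        · exact (Finset.mem_sdiff.1 (Finset.mem_inter.1 (hA h)).1).2
        · exact (Finset.mem_sdiff.1 (Finset.mem_sdiff.1 (hW h)).1).2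
      have hzB : z ∉ B := notMem_of_notMem_clF hBU (Finset.mem_sdiff.1 hz).2
      have hsub : ({z, w} : Finset α) ⊆ (Q ∪ p.1 ∪ p.2) \ B := by
        intro a ha
        rw [Finset.mem_insert, Finset.mem_singleton] at ha
        rw [Finset.mem_sdiff]
        rcases ha with rfl | rfl
        · exact ⟨hQT (Finset.mem_insert_self _ _), hzB⟩
        · refine ⟨?_, fun haB => hwQ (Finset.mem_insert_of_mem haB)⟩
          rcases Finset.mem_union.1 hw with h | h
          · exact Finset.mem_union_left _ (Finset.mem_union_right _ h)
          · exact Finset.mem_union_right _ h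
      have hzw : z ≠ w := fun h => hwQ (h ▸ Finset.mem_insert_self _ _)
      have := Finset.card_le_card hsub
      rw [Finset.card_pair hzw] at this
      exact this
    · rw [hprof1, hprof2]
  · intro p hp p' hp' heq
    rw [Finset.mem_coe, Finset.mem_product, Finset.mem_powersetCard, Finset.mem_powersetCard] at hp hp'
    simp only at heq
    -- recover `A = (T ∖ Q) ∩ ℓ` and `W = (T ∖ Q) ∖ ℓ`
    have key : ∀ (A W : Finset α), A ⊆ Aℓ → W ⊆ Wℓ →
        ((Q ∪ A ∪ W) \ Q) ∩ ℓ = A ∧ ((Q ∪ A ∪ W) \ Q) \ ℓ = W := by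
      intro A W hA hW
      constructor
      · ext a
        simp only [Finset.mem_inter, Finset.mem_sdiff, Finset.mem_union]
        constructor
        · rintro ⟨⟨(h | h) | h, haQ⟩, haℓ⟩
          · exact absurd h haQ
          · exact h
          · have := hW h
            rw [hWℓ, Finset.mem_sdiff] at this
            exact absurd haℓ this.2
        · intro h
          have := hA h
          rw [hAℓ, Finset.mem_inter, Finset.mem_sdiff] at this
          exact ⟨⟨Or.inl (Or.inr h), this.1.2⟩, this.2⟩
      · ext a
        simp only [Finset.mem_sdiff, Finset.mem_union]
        constructor
        · rintro ⟨⟨(h | h) | h, haQ⟩, haℓ⟩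
          · exact absurd h haQ
          · have := hA h
            rw [hAℓ, Finset.mem_inter] at this
            exact absurd this.2 haℓ
          · exact h
        · intro h
          have := hW h
          rw [hWℓ, Finset.mem_sdiff, Finset.mem_sdiff] at this
          exact ⟨⟨Or.inr h, this.1.2⟩, this.2⟩
    obtain ⟨e1, e2⟩ := key p.1 p.2 hp.1.1 hp.2.1
    obtain ⟨e1', e2'⟩ := key p'.1 p'.2 hp'.1.1 hp'.2.1
    rw [heq] at e1 e2
    exact Prod.ext (e1.symm.trans e1') (e2.symm.trans e2')

end Fibers

end PercRepro.Shadow
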